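/-
Copyright (c) 2026 the pub-hodgecm-mathlib formalisation cell (harness21).  Prover seat hodgecm-mathlib-LH4-p11 (g8), req620 Track A «(D-RAM) FOUR-FRAME» squad, helper lane on
h413 = stmt-HodgeConjecture-24833 (count-neutral).  Dealer∕pen LH4-plan (g13) WORD #96 (2) «LH4-p11 OWNS THE PURE CELLS»; SIG-PureCells v1 (9a3f5135) §1∕§2, FILE 2c.  2026-09-04.
-/
import Summits.HodgeConjecture.HodgeConjecture.Theorems.F0P3cDyRamLabelledOddPureStrataG1        -- FILE 2b (this seat): `shell_iff_of_mem_stratum_G1`, `tube_of_mem_stratum_G1`, `v_polarisation_latt_G1`; brings FILE 2a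
import Summits.HodgeConjecture.HodgeConjecture.Theorems.F0P3cDyRamDiagonalKappaGluedRotations      -- ★ (LH4-p09): `finsum_kappaCount_mul_stabiliserWeight_hasAxis_G2`; brings ★ κ-permutation kit
import Summits.HodgeConjecture.HodgeConjecture.Theorems.F0P3cDyRamDiagonalPermutationTwo           -- ★ §P ED. 2 (LH4-p12): `isVertexLattice_diagonal_mapGL_perm_iff`
import Summits.HodgeConjecture.HodgeConjecture.Theorems.F0P3cDyRamLabelledStrataPermutation        -- ★ p859291 (LH4-p09): `latticeInLevel_diagonal_mapGL_perm_iff`; brings ★ §P `image_mapGL_stratum`, `isElementDatum_swap`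
import HarnessLib

/-!
# Crux `H413`, line LH4 «(D-RAM) FOUR-FRAME» — (β-BAL) Stage B, THE PURE STRATA, FILE 2c: the GLUED strata `G₂ = (2ρ+s, 2ρ, 2ρ+s)` in the one-slot cell `2ρ + m* ≤ n₁`, BY TRANSPORT
# `Σᶠ_{M ∈ stratum G₂, clean shell} labelledOddCount σ ϖ 0 i Λ M ∕ [𝒰 : N(S̃′(M))] = [2ρ+s+ℓ₀ = n₂ ∧ 2∣s ∧ 2ρ ≤ min n₁ n₃] · ω(e_A)∕2 · ((q−1)q^{2ρ+s∕2−1}, 0, ω(−1)q^{2ρ+s∕2−1}((q−1)[2d ≤ s] − [s+2 = 2d]))_i`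

Cell `hodgecm-mathlib` (D-0151), FLOOR 0, crux item H413 = `stmt-HodgeConjecture-24833`, route `HCCMUnconditional`; squad F0∕P3c∕LH4.  THEOREMS ONLY (no `def`, no instance, no
notation, no `sorry`, default heartbeats); ★-only imports; lane `--supports stmt-HodgeConjecture-24833 --as helper` (count-neutral); pays NO row, states NO law.
THE MATHEMATICS (SIG-PureCells v1 §1 row G₂; LH4-p05 (g8)'s box currency).  The coordinate swap `P = (0 1)` carries the stratum `(2ρ, 2ρ+s, 2ρ+s)` of `diag(β, α, 1)` onto the stratum
`(2ρ+s, 2ρ, 2ρ+s)` of `diag(α, β, 1)` (★ §P `image_mapGL_stratum`), the polarisation `diag D` to `diag (D ∘ P)` (★ §P₂), the shell tokens of `diag(α−1, β−1, 0)` to those of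
`diag(β−1, α−1, 0)` (★ p859291) and the element datum to the swapped one (★ `isElementDatum_swap`); so FILE 2b's read, tube and polarisation valuations hold on `G₂` with
`(n₁, n₂)` interchanged, FILE 2a (slot `0` dominant, token `e_A`) gives `ω(e_A)∕2·(1, κ₂, κ₁)_i·stabiliserWeight` pointwise, and the sums over the stratum are ★
`finsum_kappaCount_mul_stabiliserWeight_hasAxis_G2` ∕ ★ `finsum_stabiliserWeight_stratum_G2_of_G1` ∘ ★ B56 (glue branch void in the cell).  A TOKEN-FREE twin gives `0` off the read.
HONEST LABEL: count-neutral; SIG-B2b3, (β-BAL), (β), T₊ OPEN; `HC_CM` is proved only modulo the 7 printed citations (2 remaining named inputs: hLiu418 = `stmt-HodgeConjecture-24832`,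
h413 = `stmt-HodgeConjecture-24833`) until rung 0 closes.
References: [Kottwitz1986BaseChangeUnits] §1 pp. 240–241 · [Rogawski1990] §4.9 Prop. 4.9.1 (a)(b) p. 55, §4.10 p. 58 · [LanglandsShelstad1987] §3 · [Jacobowitz1962] §4, §7.
-/

set_option autoImplicit false

noncomputable section

namespace Summit.HodgeConjecture.HodgeConjecture.Cruxes.H413.F0P3cDyRamLabelledOddPureStrataG2

open Matrix WithZero
open Literature.NumberTheory.Automorphic Literature.NumberTheory.Automorphic.HermitianLattice
open Literature.NumberTheory.Automorphic.UnitaryLatticeTree Literature.NumberTheory.Automorphic.UnitaryThreeFourFrame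
open Literature.NumberTheory.LocalFields Literature.NumberTheory.LocalFields.WildQuadraticDatum
open Summit.HodgeConjecture.HodgeConjecture.Cruxes.H413.F0P3cDyRamFourFramePieces
open Summit.HodgeConjecture.HodgeConjecture.Cruxes.H413.F0P3cDyRamFourFrameCensusDefs
open Summit.HodgeConjecture.HodgeConjecture.Cruxes.H413.F0P3cDyRamStageOneBDefs (mcOfRecord)
open Summit.HodgeConjecture.HodgeConjecture.Cruxes.H413.F0P3cDyRamDiagonalTorusDefs
open Summit.HodgeConjecture.HodgeConjecture.Cruxes.H413.F0P3cDyRamDiagonalStrataDefs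
open Summit.HodgeConjecture.HodgeConjecture.Cruxes.H413.F0P3cDyRamDiagonalKappaCountDefs
open Summit.HodgeConjecture.HodgeConjecture.Cruxes.H413.F0P3cDyRamLabelledOddCountDefs
open Summit.HodgeConjecture.HodgeConjecture.Cruxes.H413.F0P3cDyRamDiagonalPermutation
open Summit.HodgeConjecture.HodgeConjecture.Cruxes.H413.F0P3cDyRamDiagonalPermutationTwo (isVertexLattice_diagonal_mapGL_perm_iff)
open Summit.HodgeConjecture.HodgeConjecture.Cruxes.H413.F0P3cDyRamLabelledStrataPermutation (latticeInLevel_diagonal_mapGL_perm_iff)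
open Summit.HodgeConjecture.HodgeConjecture.Cruxes.H413.F0P3cDyRamDiagonalGluedStratum (stratum_G1_eq two_dvd_of_mem_stratum_G1)
open Summit.HodgeConjecture.HodgeConjecture.Cruxes.H413.F0P3cDyRamDiagonalKappaGluedRotations (finsum_kappaCount_mul_stabiliserWeight_hasAxis_G2)
open Summit.HodgeConjecture.HodgeConjecture.Cruxes.H413.F0P3cDyRamDiagonalGluedSocket (finsum_stabiliserWeight_hasAxis_G1)
open Summit.HodgeConjecture.HodgeConjecture.Cruxes.H413.F0P3cDyRamLabelledSplitStrata (finsum_mem_sep_eq_ite_of_forall_iff)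
open Summit.HodgeConjecture.HodgeConjecture.Cruxes.H413.F0P3cDyRamStableCountTypeZero (v_diag_eq_one diag_regular)
open Summit.HodgeConjecture.HodgeConjecture.Cruxes.H413.F0P3cDyRamDiagonalOrbitFibreCountHeads (finite_unitTorus_orbit_of_mem_normalisedStableLattices)
open Summit.HodgeConjecture.HodgeConjecture.Cruxes.H413.F0P3cDyRamLabelledOddValueOfKappa
open Summit.HodgeConjecture.HodgeConjecture.Cruxes.H413.F0P3cDyRamLabelledOddPureStrataG1
open scoped Valued WithZero Matrix MatrixGroups

variable {K : Type} [Field K] [Valued K ℤᵐ⁰]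

/-! ## §1  The swap `(0 1)` carries `G₁` of `diag(β, α, 1)` onto `G₂` of `diag(α, β, 1)`; the read, the tube and the polarisation valuations transported -/

section Transport

variable {σ : K →+* K} {ϖ : K} {d t : ℕ} {α β : K} {N₀ n₁ n₂ n₃ : ℕ}

/-- **THE `G₂` MEMBER DATA, TRANSPORTED FROM `G₁`** (token-free).  In the one-slot cell `2ρ + m* ≤ n₁`, for every `M` in the stratum `(2ρ+s, 2ρ, 2ρ+s)` of `𝓛₀(diag(α,β,1))`:
(a) the three clean-shell tokens of `X = diag(α−1, β−1, 0)` hold iff `2ρ + s + ℓ₀ = n₂`; (b) on that read, `2 ∣ s`, `2ρ + s ≤ n₂`, `2ρ ≤ n₁`, `2ρ ≤ n₃`; (c) every type-0 diagonal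
polarisation `D` of `M` has `|D₀| = exp(2ρ+s)` and `|D₁| = exp 2ρ` (FILE 2b on the swapped element ★ `isElementDatum_swap`, via ★ §P transport of stratum, tokens, polarisation).
[cite: Kottwitz1986BaseChangeUnits, §1 pp. 240–241] [cite: Jacobowitz1962, §4, §7] -/
theorem transport_of_mem_stratum_G2 (hD : IsRamifiedQuadraticDatum σ ϖ d t) (h2d : 2 ≤ d)
    (hE : IsElementDatum σ ϖ N₀ α β n₁ n₂ n₃) (hmc : mcOfRecord d ≤ N₀)
    (T : GL (Fin 3) K) (hT : (T : Matrix (Fin 3) (Fin 3) K) = Matrix.diagonal ![α, β, 1]) (ρ s : ℕ) (hρ : 1 ≤ ρ) (hs : 1 ≤ s)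
    (hcell : 2 * ρ + mstarOfRecord d ≤ n₁) {M : Submodule 𝒪[K] (Fin 3 → K)} (hM : M ∈ stratum σ ϖ T ![2 * ρ + s, 2 * ρ, 2 * ρ + s]) :
    ((LatticeInLevel ϖ (d % 2) (Matrix.diagonal ![α - 1, β - 1, 0]) M ∧ ¬ LatticeInLevel ϖ (d % 2 + 1) (Matrix.diagonal ![α - 1, β - 1, 0]) M ∧
          LatticeInLevel ϖ (mcOfRecord d) (Matrix.diagonal ![(α - 1) * (α - 1), (β - 1) * (β - 1), 0]) M) ↔ 2 * ρ + s + d % 2 = n₂) ∧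
      (2 * ρ + s + d % 2 = n₂ → 2 ∣ s ∧ 2 * ρ + s ≤ n₂ ∧ 2 * ρ ≤ n₁ ∧ 2 * ρ ≤ n₃) ∧
      (∀ D : Fin 3 → K, (∀ i, D i ≠ 0) → IsVertexLattice σ ϖ (Matrix.diagonal D) 0 M →
        Valued.v (D 0) = WithZero.exp ((2 * ρ + s : ℕ) : ℤ) ∧ Valued.v (D 1) = WithZero.exp ((2 * ρ : ℕ) : ℤ)) := by
  have hD' := hD
  obtain ⟨hσ, hvσ, hϖ, hfix, -, -, -⟩ := hD'
  have hE' := isElementDatum_swap hE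
  obtain ⟨P, hP⟩ := exists_gl_coe_eq_permMatrix (K := K) (Equiv.swap (0 : Fin 3) 1)
  have ha : (![2 * ρ + s, 2 * ρ, 2 * ρ + s] : Fin 3 → ℕ) ∘ ⇑(Equiv.swap (0 : Fin 3) 1).symm = ![2 * ρ, 2 * ρ + s, 2 * ρ + s] := by
    ext i; fin_cases i <;> rfl
  have hd : (![α, β, 1] : Fin 3 → K) ∘ ⇑(Equiv.swap (0 : Fin 3) 1).symm = ![β, α, 1] := by
    ext i; fin_cases i <;> rfl
  have he₁ : (![α - 1, β - 1, 0] : Fin 3 → K) ∘ ⇑(Equiv.swap (0 : Fin 3) 1).symm = ![β - 1, α - 1, 0] := by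
    ext i; fin_cases i <;> rfl
  have he₂ : (![(α - 1) * (α - 1), (β - 1) * (β - 1), 0] : Fin 3 → K) ∘ ⇑(Equiv.swap (0 : Fin 3) 1).symm = ![(β - 1) * (β - 1), (α - 1) * (α - 1), 0] := by
    ext i; fin_cases i <;> rfl
  have hT'' : ((P⁻¹ * T * P : GL (Fin 3) K) : Matrix (Fin 3) (Fin 3) K) = Matrix.diagonal ![β, α, 1] := by rw [coe_conj_eq_diagonal P hP T hT, hd]
  -- the preimage `M'` in the `G₁` stratum of the swapped element
  have himg := image_mapGL_stratum σ ϖ P hP T (![2 * ρ + s, 2 * ρ, 2 * ρ + s] : Fin 3 → ℕ)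
  rw [ha] at himg
  rw [← himg] at hM
  obtain ⟨M', hM', rfl⟩ := hM
  have hread := shell_iff_of_mem_stratum_G1 hD h2d hE' hmc (P⁻¹ * T * P) hT'' ρ s hρ hs hcell M' hM'
  refine ⟨?_, fun hP' => ?_, fun D hD0 hV => ?_⟩
  · rw [latticeInLevel_diagonal_mapGL_perm_iff P hP, latticeInLevel_diagonal_mapGL_perm_iff P hP, latticeInLevel_diagonal_mapGL_perm_iff P hP, he₁, he₂]
    exact hread
  · obtain ⟨h1, h2, h3⟩ := tube_of_mem_stratum_G1 hD hE' (P⁻¹ * T * P) hT'' ρ s hρ hs hcell hP' hM'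
    exact ⟨two_dvd_of_mem_stratum_G1 hvσ hfix hϖ (P⁻¹ * T * P) hρ hs hM', h1, h2, h3⟩
  · rw [isVertexLattice_diagonal_mapGL_perm_iff σ ϖ P hP D 0 M'] at hV
    have hM'' := hM'
    rw [stratum_G1_eq hvσ hfix hϖ (P⁻¹ * T * P) hρ hs] at hM''
    obtain ⟨x, ζ, y'', hx, hζ, hy, hMe, -, -⟩ := hM''
    obtain ⟨⟨-, -⟩, -, hnorm⟩ := hM'.1
    rw [hMe] at hnorm hV
    obtain ⟨h0, h1⟩ := v_polarisation_latt_G1 hvσ hϖ (D := D ∘ ⇑(Equiv.swap (0 : Fin 3) 1).symm) (fun i => hD0 _) hρ hs hx hζ hy hnorm hV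
    exact ⟨by simpa using h1, by simpa using h0⟩

end Transport

/-! ## §2  The `G₂ = (2ρ+s, 2ρ, 2ρ+s)` stratum on the clean shell, in the one-slot cell `2ρ + m* ≤ n₁` -/

section Strata

variable [CompleteSpace K] [Fintype 𝓀[K]] {σ : K →+* K} {ϖ : K} {d t : ℕ} {α β : K} {N₀ n₁ n₂ n₃ : ℕ}

omit [CompleteSpace K] [Fintype 𝓀[K]] in
/-- **`G₂` OFF THE READ, TOKEN-FREE** (LH4-p05 (g8) parity ask): in the cell `2ρ + m* ≤ n₁`, if `¬ (2ρ + s + ℓ₀ = n₂ ∧ 2 ∣ s ∧ 2ρ ≤ min n₁ n₃)` the clean-shell cut of the stratum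
`(2ρ+s, 2ρ, 2ρ+s)` carries labelled odd value `0` in every slot. [cite: Kottwitz1986BaseChangeUnits, §1 pp. 240–241] [cite: Rogawski1990, §4.9 Prop. 4.9.1 (a) p. 55] -/
theorem finsum_stratum_G2_shell_labelledOdd_div_relIndex_eq_zero_of_not (hD : IsRamifiedQuadraticDatum σ ϖ d t) (h2d : 2 ≤ d)
    (hE : IsElementDatum σ ϖ N₀ α β n₁ n₂ n₃) (hmc : mcOfRecord d ≤ N₀)
    (T : GL (Fin 3) K) (hT : (T : Matrix (Fin 3) (Fin 3) K) = Matrix.diagonal ![α, β, 1]) (ρ s : ℕ) (hρ : 1 ≤ ρ) (hs : 1 ≤ s)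
    (hcell : 2 * ρ + mstarOfRecord d ≤ n₁) (hnot : ¬ (2 * ρ + s + d % 2 = n₂ ∧ 2 ∣ s ∧ 2 * ρ ≤ min n₁ n₃)) (i : Fin 3) :
    ∑ᶠ M ∈ {M : Submodule 𝒪[K] (Fin 3 → K) | M ∈ stratum σ ϖ T ![2 * ρ + s, 2 * ρ, 2 * ρ + s] ∧
        (LatticeInLevel ϖ (d % 2) (Matrix.diagonal ![α - 1, β - 1, 0]) M ∧ ¬ LatticeInLevel ϖ (d % 2 + 1) (Matrix.diagonal ![α - 1, β - 1, 0]) M ∧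
          LatticeInLevel ϖ (mcOfRecord d) (Matrix.diagonal ![(α - 1) * (α - 1), (β - 1) * (β - 1), 0]) M)},
      (labelledOddCount σ ϖ 0 i (valueClassLabel σ ϖ (α - 1) (β - 1) (mstarOfRecord d) d) M : ℚ) /
        ((((unitStabilizer M).map (unitNormMap σ 3)).relIndex (fixedUnitTorus σ 3) : ℕ) : ℚ) = 0 := by
  classical
  rw [finsum_mem_sep_eq_ite_of_forall_iff (stratum σ ϖ T ![2 * ρ + s, 2 * ρ, 2 * ρ + s]) _ _
    (fun M hM => (transport_of_mem_stratum_G2 hD h2d hE hmc T hT ρ s hρ hs hcell hM).1)]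
  by_cases hP : 2 * ρ + s + d % 2 = n₂
  · rw [if_pos hP]
    have hzero : ∀ M ∈ stratum σ ϖ T ![2 * ρ + s, 2 * ρ, 2 * ρ + s],
        (labelledOddCount σ ϖ 0 i (valueClassLabel σ ϖ (α - 1) (β - 1) (mstarOfRecord d) d) M : ℚ) /
            ((((unitStabilizer M).map (unitNormMap σ 3)).relIndex (fixedUnitTorus σ 3) : ℕ) : ℚ) = 0 := by
      intro M hM
      obtain ⟨h2s, -, h2, h3⟩ := (transport_of_mem_stratum_G2 hD h2d hE hmc T hT ρ s hρ hs hcell hM).2.1 hP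
      exact absurd ⟨hP, h2s, le_min h2 h3⟩ hnot
    rw [finsum_mem_congr rfl hzero]
    simp
  · rw [if_neg hP]

/-- **THE `G₂ = (2ρ+s, 2ρ, 2ρ+s)` STRATUM ON THE CLEAN SHELL, ONE-SLOT CELL** (`ρ, s ≥ 1`; `2 ≤ d ≤ N₀`, `mcOfRecord d ≤ N₀`, `|2| < 1`; cell `2ρ + m* ≤ n₁`; token `e_A` of `α − 1`):
`Σᶠ_{M ∈ stratum G₂, shell} labelledOddCount σ ϖ 0 i Λ M ∕ [𝒰 : N(S̃′(M))] = [2ρ + s + ℓ₀ = n₂ ∧ 2 ∣ s ∧ 2ρ ≤ min n₁ n₃] · ω(e_A)∕2 ·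
((q−1)·q^{2ρ+s∕2−1}, 0, ω(−1)·q^{2ρ+s∕2−1}·((q−1)·[2d ≤ s] − [s+2 = 2d]))_i` — FILE 2a over ★ κG2 (rotations) ∕ ★ B56 behind the transported read.
[cite: Kottwitz1986BaseChangeUnits, §1 pp. 240–241] [cite: Rogawski1990, §4.9 Prop. 4.9.1 (a)(b) p. 55, §4.10 p. 58] [cite: LanglandsShelstad1987, §3] -/
theorem finsum_stratum_G2_shell_labelledOdd_div_relIndex_eq (hD : IsRamifiedQuadraticDatum σ ϖ d t) (h2 : Valued.v (2 : K) < 1) (h2d : 2 ≤ d)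
    (hE : IsElementDatum σ ϖ N₀ α β n₁ n₂ n₃) (hN₀ : d ≤ N₀) (hmc : mcOfRecord d ≤ N₀)
    (T : GL (Fin 3) K) (hT : (T : Matrix (Fin 3) (Fin 3) K) = Matrix.diagonal ![α, β, 1]) (ρ s : ℕ) (hρ : 1 ≤ ρ) (hs : 1 ≤ s)
    (hcell : 2 * ρ + mstarOfRecord d ≤ n₁)
    {eA : K} (hσeA : σ eA = eA) (heA1 : Valued.v eA = 1)
    (heA : Valued.v ((ϖ ^ mstarOfRecord d)⁻¹ * ((α - 1) * ((ϖ * σ ϖ) ^ ((n₂ - d % 2) / 2))⁻¹ - eA * ((ϖ - σ ϖ) * ((ϖ * σ ϖ) ^ ((d - d % 2) / 2))⁻¹))) ≤ 1)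
    (i : Fin 3) :
    ∑ᶠ M ∈ {M : Submodule 𝒪[K] (Fin 3 → K) | M ∈ stratum σ ϖ T ![2 * ρ + s, 2 * ρ, 2 * ρ + s] ∧
        (LatticeInLevel ϖ (d % 2) (Matrix.diagonal ![α - 1, β - 1, 0]) M ∧ ¬ LatticeInLevel ϖ (d % 2 + 1) (Matrix.diagonal ![α - 1, β - 1, 0]) M ∧
          LatticeInLevel ϖ (mcOfRecord d) (Matrix.diagonal ![(α - 1) * (α - 1), (β - 1) * (β - 1), 0]) M)},
      (labelledOddCount σ ϖ 0 i (valueClassLabel σ ϖ (α - 1) (β - 1) (mstarOfRecord d) d) M : ℚ) /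
        ((((unitStabilizer M).map (unitNormMap σ 3)).relIndex (fixedUnitTorus σ 3) : ℕ) : ℚ) =
      if 2 * ρ + s + d % 2 = n₂ ∧ 2 ∣ s ∧ 2 * ρ ≤ min n₁ n₃ then
        (normSign σ eA : ℚ) / 2 *
          (![((Fintype.card 𝓀[K] : ℚ) - 1) * (Fintype.card 𝓀[K] : ℚ) ^ (2 * ρ + s / 2 - 1), (0 : ℚ),
              (normSign σ (-1 : K) : ℚ) * (Fintype.card 𝓀[K] : ℚ) ^ (2 * ρ + s / 2 - 1) *
                ((if 2 * d ≤ s then (Fintype.card 𝓀[K] : ℚ) - 1 else 0) - (if s + 2 = 2 * d then 1 else 0))] : Fin 3 → ℚ) i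
      else 0 := by
  classical
  have hD' := hD
  obtain ⟨hσ, hvσ, hϖ, hfix, -, -, -⟩ := hD'
  have hϖ0 : ϖ ≠ 0 := fun h0 => by rw [h0, map_zero] at hϖ; exact WithZero.coe_ne_zero hϖ.symm
  have hβ : Valued.v (β - 1) = Valued.v ϖ ^ n₁ := hE.2.2.2.2.2.1
  have hn₁ : N₀ ≤ n₁ := hE.2.2.2.2.2.2.2.2.1
  have hn₂ : N₀ ≤ n₂ := hE.2.2.2.2.2.2.2.2.2.1
  have hmsv : mstarOfRecord d = d % 2 + 2 * d - 1 := rfl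
  have htr := fun (M : Submodule 𝒪[K] (Fin 3 → K)) (hM : M ∈ stratum σ ϖ T ![2 * ρ + s, 2 * ρ, 2 * ρ + s]) =>
    transport_of_mem_stratum_G2 hD h2d hE hmc T hT ρ s hρ hs hcell hM
  have hcell' := hcell
  rw [hmsv] at hcell'
  have hsv := v_diag_eq_one hvσ hE
  have hreg := diag_regular hE
  by_cases hcond : 2 * ρ + s + d % 2 = n₂ ∧ 2 ∣ s ∧ 2 * ρ ≤ min n₁ n₃
  swap
  · rw [if_neg hcond]
    exact finsum_stratum_G2_shell_labelledOdd_div_relIndex_eq_zero_of_not hD h2d hE hmc T hT ρ s hρ hs hcell hcond i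
  obtain ⟨hP, ⟨j', hj'⟩, hc⟩ := hcond
  rw [if_pos ⟨hP, Dvd.intro j' hj'.symm, hc⟩, finsum_mem_sep_eq_ite_of_forall_iff (stratum σ ϖ T ![2 * ρ + s, 2 * ρ, 2 * ρ + s]) _ _ (fun M hM => (htr M hM).1),
    if_pos hP]
  -- the half-depth of the dominant slot `0`
  set j : ℕ := ρ + j' with hjdef
  have hjs : 2 * j = 2 * ρ + s := by omega
  have hjn : (n₂ - d % 2) / 2 = j := by omega
  rw [hjn] at heA
  -- pointwise: FILE 2a (slot `0` dominant) on every member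
  have hval : ∀ M ∈ stratum σ ϖ T ![2 * ρ + s, 2 * ρ, 2 * ρ + s],
      (labelledOddCount σ ϖ 0 i (valueClassLabel σ ϖ (α - 1) (β - 1) (mstarOfRecord d) d) M : ℚ) /
          ((((unitStabilizer M).map (unitNormMap σ 3)).relIndex (fixedUnitTorus σ 3) : ℕ) : ℚ) =
        (normSign σ eA : ℚ) / 2 * ((((![1, kappaCount σ ϖ 0 2 M, kappaCount σ ϖ 0 1 M] : Fin 3 → ℤ) i) : ℤ) : ℚ) * stabiliserWeight σ M := by
    intro M hM
    obtain ⟨⟨g, hg⟩, -, hnorm⟩ := hM.1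
    obtain ⟨D₁, hD₁, hV₁⟩ := hM.2.1
    obtain ⟨hvD0, hvD1⟩ := (htr M hM).2.2 D₁ (fun k => (hD₁ k).2) hV₁
    -- slot `1` is small: `|D₁·(β−1)| = |ϖ|^{n₁ − 2ρ} ≤ |ϖ|^{m*}`
    have hsmall : ∀ w ∈ M, Valued.v ((ϖ ^ (d % 2 + 2 * d - 1))⁻¹ * (D₁ 1 * (β - 1) * (w 1 * σ (w 1)))) ≤ 1 := by
      intro w hw
      have hw1 : Valued.v (w 1) ≤ 1 := (hnorm 1).1 w hw
      have hm0 : Valued.v (ϖ ^ (d % 2 + 2 * d - 1)) ≠ 0 := (Valuation.ne_zero_iff _).2 (pow_ne_zero _ hϖ0)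
      have hDB : Valued.v (D₁ 1) * Valued.v (β - 1) ≤ Valued.v (ϖ ^ (d % 2 + 2 * d - 1)) := by
        rw [hvD1, hβ, v_varpi_pow hϖ, ← WithZero.exp_add, map_pow, v_varpi_pow hϖ, WithZero.exp_le_exp]; push_cast; omega
      rw [map_mul, map_inv₀, map_mul, map_mul, map_mul, hvσ]
      calc (Valued.v (ϖ ^ (d % 2 + 2 * d - 1)))⁻¹ * (Valued.v (D₁ 1) * Valued.v (β - 1) * (Valued.v (w 1) * Valued.v (w 1)))
          ≤ (Valued.v (ϖ ^ (d % 2 + 2 * d - 1)))⁻¹ * (Valued.v (ϖ ^ (d % 2 + 2 * d - 1)) * (1 * 1)) := by gcongr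
        _ = 1 := by rw [mul_one, mul_one, inv_mul_cancel₀ hm0]
    have hvD0' : Valued.v (D₁ 0 * (ϖ * σ ϖ) ^ j) = 1 := by
      rw [map_mul, hvD0, map_pow, map_mul, hvσ, ← pow_two, ← pow_mul, v_varpi_pow hϖ, ← WithZero.exp_add, ← WithZero.exp_zero]; congr 1; push_cast; omega
    have h := labelledOddCount_div_relIndex_eq_normSign_mul_kappaCount_of_snd_small hD (α - 1) (β - 1) g hg hnorm
      (finite_unitTorus_orbit_of_mem_normalisedStableLattices hϖ hsv hreg T hT hM.1) hD₁ hV₁ hsmall j hvD0' hσeA heA1 heA i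
    rw [hmsv, h]
  rw [finsum_mem_congr rfl hval]
  -- the three slots over ★ κG2 (rotations) ∕ ★ B56 transported (glue branch void: `n₂ < n₁ + s` in the cell)
  have hng : ¬ (2 ∣ s ∧ n₁ = n₃ ∧ n₂ = n₁ + s ∧ n₁ < 2 * ρ ∧ 2 * ρ - n₁ ≤ n₁ - d + 1) := fun h => by omega
  have hglue : 2 ∣ s → n₁ = n₃ → n₂ = n₁ + s → n₁ < 2 * ρ → 2 * ρ - n₁ ≤ n₁ - d + 1 → Valued.v ((0 : K) + (α - 1) / (β - 1)) ≤ Valued.v ϖ ^ (2 * ρ + s - n₁) :=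
    fun _ _ h3 _ _ => by omega
  have hκ1 := finsum_kappaCount_mul_stabiliserWeight_hasAxis_G2 hD h2 hE hN₀ hT ρ s hρ hs 1 0 (map_zero σ) hglue
  have hκ2 := finsum_kappaCount_mul_stabiliserWeight_hasAxis_G2 hD h2 hE hN₀ hT ρ s hρ hs 2 0 (map_zero σ) hglue
  have hsw := finsum_stabiliserWeight_stratum_G2_of_G1 hE hT ρ s
    (fun m₁ m₂ m₃ => (if 2 ∣ s ∧ 2 * ρ ≤ min m₂ m₃ ∧ 2 * ρ + s ≤ m₁ then (((Fintype.card 𝓀[K] : ℚ) - 1) * (Fintype.card 𝓀[K] : ℚ) ^ (2 * ρ + s / 2 - 1)) else 0) +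
      (if 2 ∣ s ∧ m₂ = m₃ ∧ m₁ = m₂ + s ∧ m₂ < 2 * ρ ∧ 2 * ρ - m₂ ≤ m₂ - d + 1
        then ((Fintype.card 𝓀[K] : ℚ) ^ (2 * ρ + s / 2 - (2 * ρ - m₂ + 1) / 2)) else 0))
    (fun T' hE'' hT' => finsum_stabiliserWeight_hasAxis_G1 hD h2 hE'' hN₀ hT' ρ s hρ hs)
  rw [if_neg hng, add_zero] at hκ1 hκ2
  have hng' : ¬ (2 ∣ s ∧ n₁ = n₃ ∧ n₂ = n₁ + s ∧ n₁ < 2 * ρ ∧ 2 * ρ - n₁ ≤ n₁ - d + 1) := hng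
  simp only [hng', if_false, add_zero] at hsw
  have e2s : s / 2 = j' := by omega
  by_cases hi0 : i = 0
  · -- dominant slot `0`: the plain orbit count
    subst hi0
    have hpt : ∀ M ∈ stratum σ ϖ T ![2 * ρ + s, 2 * ρ, 2 * ρ + s],
        (normSign σ eA : ℚ) / 2 * ((((![1, kappaCount σ ϖ 0 2 M, kappaCount σ ϖ 0 1 M] : Fin 3 → ℤ) 0) : ℤ) : ℚ) * stabiliserWeight σ M =
          (normSign σ eA : ℚ) / 2 * stabiliserWeight σ M := fun M _ => by
      simp only [Matrix.cons_val_zero]; push_cast; ring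
    rw [finsum_mem_congr rfl hpt, ← mul_finsum_mem, hsw,
      if_pos (show 2 ∣ s ∧ 2 * ρ ≤ min n₁ n₃ ∧ 2 * ρ + s ≤ n₂ from ⟨Dvd.intro j' hj'.symm, hc, by omega⟩)]
    simp [e2s]
  by_cases hi1 : i = 1
  · -- own slot `1`: the `κ₂`-weighted G2 socket vanishes on the tube
    subst hi1
    have hpt : ∀ M ∈ stratum σ ϖ T ![2 * ρ + s, 2 * ρ, 2 * ρ + s],
        (normSign σ eA : ℚ) / 2 * ((((![1, kappaCount σ ϖ 0 2 M, kappaCount σ ϖ 0 1 M] : Fin 3 → ℤ) 1) : ℤ) : ℚ) * stabiliserWeight σ M =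
          (normSign σ eA : ℚ) / 2 * ((kappaCount σ ϖ 0 2 M : ℚ) * stabiliserWeight σ M) := fun M _ => by
      simp only [Matrix.cons_val_one, Matrix.cons_val_zero]; ring
    rw [finsum_mem_congr rfl hpt, ← mul_finsum_mem, hκ2,
      if_pos (show 2 ∣ s ∧ 2 * ρ ≤ min n₁ n₃ ∧ 2 * ρ + s ≤ n₂ from ⟨Dvd.intro j' hj'.symm, hc, by omega⟩)]
    simp
  · -- third slot `2`: the `κ₁`-weighted G2 socket
    obtain rfl : i = 2 := by
      fin_cases i
      · exact absurd rfl hi0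
      · exact absurd rfl hi1
      · rfl
    have hpt : ∀ M ∈ stratum σ ϖ T ![2 * ρ + s, 2 * ρ, 2 * ρ + s],
        (normSign σ eA : ℚ) / 2 * ((((![1, kappaCount σ ϖ 0 2 M, kappaCount σ ϖ 0 1 M] : Fin 3 → ℤ) 2) : ℤ) : ℚ) * stabiliserWeight σ M =
          (normSign σ eA : ℚ) / 2 * ((kappaCount σ ϖ 0 1 M : ℚ) * stabiliserWeight σ M) := fun M _ => by
      simp only [Matrix.cons_val_two, Matrix.tail_cons, Matrix.head_cons]; ring
    rw [finsum_mem_congr rfl hpt, ← mul_finsum_mem, hκ1,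
      if_pos (show 2 ∣ s ∧ 2 * ρ ≤ min n₁ n₃ ∧ 2 * ρ + s ≤ n₂ from ⟨Dvd.intro j' hj'.symm, hc, by omega⟩)]
    simp [e2s]

end Strata

end Summit.HodgeConjecture.HodgeConjecture.Cruxes.H413.F0P3cDyRamLabelledOddPureStrataG2

end
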